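import Summits.Parity.GeneralizedHardyLittlewood.Theorems.PrimeLevelFamEdgeMomentsBeyondDiagonalDiagDecorWeightRungTwo
import HarnessLib

/-!
# Route `PrimeLevelFamEdge`, crux K_A `MomentsBeyondDiagonal` (stmt-Parity-20007), line «petersson_layers» v4, stub `stub_diag`:
# **the SIXTH central divisor-log moment on squarefree numbers: `M₆ = τ·(15P₂³ − 30P₂P₄ + 16P₆)`** — the new decoration of rung 3
# (orders `(1,3)`, `(3,3)`) and of `(2,4)`, `(0,4)`-type weights of the generic Hecke algebra `…DiagDecorWeightGeneric`

After rung 2 (`M₄ = τ(3P₂² − 2P₄)`, `…DiagDecorWeightRungTwo`, whose Selberg-form engine is `…DiagDecorM4Family`), the orders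
`(i,j)` with `i + j = 6` of `…DiagDecorOrderHecke.heckeSum_order_eq` bring the sixth moment `M₆(k) = Σ_{d∣k}(2log d − log k)⁶`.
On squarefree `k` (generating function `Σ_{d∣k}(d²/k)^t = τ(k)Π_{p∣k}cosh(t log p)`, `6!·[t⁶]`):

* `centralMoment_five` — `M₅ = 0`;
* `centralMoment_six_of_squarefree` — **`M₆ = τ·(15P₂³ − 30P₂P₄ + 16P₆)`**, `P_m(k) = Σ_{p∣k}log^m p`.

The corresponding coprime Möbius–Selberg sums again have NO main term (`[t⁶]((s²−t²)H)` regular at `s = 0`); the needed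
`P_{i+1}`-decorated sums for all `i` are `…DiagDecorPrimePowTwo.abs_coprimeSumPow_primePow_add_le_of_two_le`; the multi-peel cross
terms (`P₂P₄`, `P₂³`) are the next bricks. Def-free; theorems only. Helper `--supports stmt-Parity-20007`; closes nothing; K_A, K_B
and the Parity summit are NOT proved; nothing about Landau–Siegel zeros.

## References
* E. Kowalski, P. Michel, J. VanderKam, J. reine angew. Math. 526 (2000), (21)–(28) pp. 12–15.
  [cite: KowalskiMichelVanderKam2000, (23)–(28) — derivation (Hecke-divisor bookkeeping of the order-(i,j) diagonal weight)]
-/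

noncomputable section

open scoped Real ArithmeticFunction.Moebius
open Finset ArithmeticFunction

namespace Summit.Parity.GeneralizedHardyLittlewood.Theorems.MomentsBeyondDiagonal.DiagKernel

/-- `M₅ = 0` (odd central moment). [folklore] -/
theorem centralMoment_five (k : ℕ) : ∑ d ∈ k.divisors, (2 * Real.log d - Real.log k) ^ 5 = 0 :=
  centralMoment_eq_zero_of_odd (by decide) k

/-- **`M₆ = τ·(15P₂³ − 30P₂P₄ + 16P₆)` on squarefree numbers**:
`Σ_{d∣k}(2log d − log k)⁶ = τ(k)·(15(Σ_{p∣k}log²p)³ − 30(Σ_{p∣k}log²p)(Σ_{p∣k}log⁴p) + 16Σ_{p∣k}log⁶p)` for squarefree `k`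
(sixth moment of a sum of independent signs). [folklore] -/
theorem centralMoment_six_of_squarefree {k : ℕ} (hk : Squarefree k) :
    ∑ d ∈ k.divisors, (2 * Real.log d - Real.log k) ^ 6 =
      (k.divisors.card : ℝ) *
        (15 * (∑ p ∈ k.primeFactors, Real.log p ^ 2) ^ 3 -
          30 * (∑ p ∈ k.primeFactors, Real.log p ^ 2) * (∑ p ∈ k.primeFactors, Real.log p ^ 4) +
          16 * ∑ p ∈ k.primeFactors, Real.log p ^ 6) := by
  induction k using Nat.recOnPosPrimePosCoprime with
  | zero => exact absurd hk not_squarefree_zero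
  | one => simp
  | prime_pow p n hp hn =>
    have hn1 : n = 1 := ((Nat.squarefree_pow_iff hp.ne_one hn.ne').1 hk).2
    subst hn1
    rw [pow_one, centralMoment_prime 6 hp, hp.divisors, Finset.card_pair hp.one_lt.ne, hp.primeFactors,
      Finset.sum_singleton, Finset.sum_singleton, Finset.sum_singleton]
    ring
  | coprime a b ha hb hab iha ihb =>
    have hsq := Nat.squarefree_mul_iff.1 hk
    have ha0 : a ≠ 0 := by omega
    have hb0 : b ≠ 0 := by omega
    have hmul := centralMoment_mul_of_coprime 6 ha0 hb0 hab
    push_cast at hmul ⊢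
    rw [hmul]
    simp only [Finset.sum_range_succ, Finset.sum_range_zero, zero_add, Nat.sub_self, Nat.sub_zero,
      iha hsq.2.1, ihb hsq.2.2, centralMoment_one, centralMoment_zero, centralMoment_three, centralMoment_five,
      centralMoment_two_of_squarefree hsq.2.1, centralMoment_two_of_squarefree hsq.2.2,
      centralMoment_four_of_squarefree hsq.2.1, centralMoment_four_of_squarefree hsq.2.2]
    rw [Nat.Coprime.card_divisors_mul hab, Nat.Coprime.primeFactors_mul hab,
      Finset.sum_union (Nat.Coprime.disjoint_primeFactors hab),
      Finset.sum_union (Nat.Coprime.disjoint_primeFactors hab),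
      Finset.sum_union (Nat.Coprime.disjoint_primeFactors hab)]
    push_cast
    norm_num [Nat.choose]
    ring

end Summit.Parity.GeneralizedHardyLittlewood.Theorems.MomentsBeyondDiagonal.DiagKernel

end
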